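import Summits.Ventures.LatticeQCDFlow.Scoring.BesselToeplitzAndreief
import Literature.RepresentationTheory.CompactGroups.WeylIntegralFormula
import Summits.Ventures.LatticeQCDFlow.Scaling.LatticePeeling
import HarnessLib

/-!
# The `U(N)` one-plaquette partition function for EVERY `N`: `∫_{U(N)} e^{x Re tr U} dU = det[I_{|i−j|}(x)]_{i,j<N}`

HONEST FRAMING: exact (Metropolis-corrected) sampling algorithms for lattice gauge theory;
figures of merit are autocorrelation/cost numbers at stated couplings and volumes; no
continuum-physics claim.

Venture `LatticeQCDFlow` (cell pub-lqcd), sub-topic `Scoring`; FANOUT row 5 (`s0-sun-a`), GEN-17.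
NEW WORK of the cell (placement rule).  Row 5's exact two-dimensional plaquette ORACLE column so far
covers `U(1)` (`I₁/I₀`), `SU(2)` (`I₂/I₁`) and `SU(3)` (GEN-6/16: the Weyl-torus law, the Bars–Green
series `Σ_q det[I_{|q+i−j|}]_{3×3}`, unconditional on the Haar measure since GEN-17's `SU3HaarWeylDischarge`).
With Weyl's integral formula for `U(n)` now a THEOREM of the tree
(`Literature.RepresentationTheory.CompactGroups.weylIntegralFormula_unitary_holds`, class-function form
`WeylIntegration.lintegral_unitaryGroup_eq_angleIntegral`, 2026-08-23) and part 1
(`BesselToeplitzAndreief`: `∫_{(−π,π]^N} Π_b e^{x cos θ_b} |Δ|² dθ = (2π)^N N! det[I_{|i−j|}(x)]`), this file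
gives the one-plaquette partition function of `U(N)` lattice gauge theory in closed form FOR EVERY `N` —
the Bars–Green / Gross–Witten Toeplitz determinant of modified Bessel functions:

* §4 **the Haar side**: `e^{x Re tr U}` is a class function, `Re tr diag(e^{iθ}) = Σ_b cos θ_b`, so for every
  finite index type `n`, `N = |n|`, and every real `x`,
  `∫_{U(n)} e^{x Re tr U} dU = det[I_{|i−j|}(x)]_{i,j : Fin N}` (`integral_haar_unitaryGroup_exp_mul_trace_re`,
  with its `ℝ≥0∞` form), and the determinant is POSITIVE;
* §5 `n = Fin N` literally; in theory-2's vocabulary the `U(N)` one-plaquette integral of the lattice model is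
  **`z₁(unitaryFundamentalRep (Fin N), β) = ∫ e^{−β(N − Re tr U)} dU = e^{−Nβ} det[I_{|i−j|}(β)]_{N×N}`**
  (`z1_unitary_eq_det`); sanity checks `N = 1`: `I₀(x)` (`z₁^{U(1)}(β) = e^{−β} I₀(β)`) and `N = 2`:
  `I₀(x)² − I₁(x)²`.

So the `U(N)` two-dimensional plaquette oracle for any `N` is `(1/N) d/dx log det[I_{|i−j|}(x)]`; this file
proves the partition-function identity (the derivative / plaquette form is left to a sequel).  Published
forms of the result: I. Bars, F. Green, Phys. Rev. D 20 (1979) 3311, (1.4)–(1.6); D. Gross, E. Witten,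
Phys. Rev. D 21 (1980) 446.  No `def`, nothing cited as a fact (Weyl's formula is imported as a proved
theorem), 0 sorry.
-/

noncomputable section

open Real MeasureTheory Finset Complex Equiv
open scoped ENNReal
open Literature.MathematicalPhysics.QuantumFieldTheory (haarProbability)
open Literature.MathematicalPhysics.QuantumLattice
open Literature.Analysis.FunctionSpaces
open Literature.RepresentationTheory.CompactGroups
open Literature.RepresentationTheory.CompactGroups.WeylIntegration
open Literature.LinearAlgebra.Matrix (diagonalTorus)

namespace Summit.Ventures.LatticeQCDFlow.Scoring

variable {n : Type*} [Fintype n] [DecidableEq n]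

/-! ### 4. The Haar side: `∫_{U(n)} e^{x Re tr U} dU = det[I_{|i−j|}(x)]` -/

/-- `Re tr diag(e^{iθ}) = Σ_b cos θ_b`. -/
theorem trace_re_torusPt (θ : n → ℝ) :
    ((((torusPt θ : diagonalTorus n) : Matrix.unitaryGroup n ℂ) : Matrix n n ℂ).trace).re
      = ∑ b, Real.cos (θ b) := by
  rw [coe_torusPt, Matrix.trace_diagonal, Complex.re_sum]
  refine Finset.sum_congr rfl fun b _ => ?_
  rw [show (θ b : ℂ) * I = ((θ b : ℝ) : ℂ) * I from rfl, Complex.exp_ofReal_mul_I_re]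

/-- `e^{x Re tr U}` is a class function on `U(n)`: `Re tr(g U g⁻¹) = Re tr U`. -/
theorem trace_conj_unitaryGroup (g u : Matrix.unitaryGroup n ℂ) :
    (((g * u * g⁻¹ : Matrix.unitaryGroup n ℂ)) : Matrix n n ℂ).trace = ((u : Matrix.unitaryGroup n ℂ) : Matrix n n ℂ).trace := by
  have hg : star (g : Matrix n n ℂ) * (g : Matrix n n ℂ) = 1 := Matrix.mem_unitaryGroup_iff'.mp g.2
  rw [show (((g * u * g⁻¹ : Matrix.unitaryGroup n ℂ)) : Matrix n n ℂ)
      = (g : Matrix n n ℂ) * (u : Matrix n n ℂ) * star (g : Matrix n n ℂ) from rfl,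
    Matrix.trace_mul_cycle, hg, one_mul]

/-- **THE WEIGHTED VANDERMONDE DETERMINANT IS NON-NEGATIVE**: `0 ≤ det[I_{|i−j|}(x)]_{i,j}` (it is a positive
multiple of the integral of a non-negative function, §3). -/
theorem det_besselI_toeplitz_enum_nonneg (x : ℝ) :
    0 ≤ (Matrix.of fun i j : n => besselI (((enum n i : ℕ) : ℤ) - ((enum n j : ℕ) : ℤ)).natAbs x).det := by
  have h := integral_cube_exp_mul_sum_cos_mul_prod_norm_sub_sq (n := n) x
  have hpos : (0 : ℝ) < (2 * π) ^ Fintype.card n * (Fintype.card n).factorial := by positivity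
  have hnn : 0 ≤ ∫ θ, Real.exp (x * ∑ b, Real.cos (θ b)) * ∏ p : OD n, ‖cexp (θ p.1.1 * I) - cexp (θ p.1.2 * I)‖ ^ 2
      ∂(Measure.pi fun _ : n => (volume : Measure ℝ).restrict (Set.Ioc (-π) π)) :=
    integral_nonneg fun θ => mul_nonneg (Real.exp_nonneg _) (Finset.prod_nonneg fun p _ => sq_nonneg _)
  rw [h] at hnn
  exact nonneg_of_mul_nonneg_right hnn hpos

/-- **THE `U(n)` ONE-PLAQUETTE PARTITION FUNCTION, `ℝ≥0∞` FORM**: for every finite index type `n` and real `x`,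
`∫⁻_{U(n)} e^{x Re tr U} dU = det[I_{|i−j|}(x)]_{i,j}` (entries indexed through `enum n`) — Weyl's integral
formula for `U(n)` (class-function form, the tree's theorem) followed by §3. -/
theorem lintegral_haar_unitaryGroup_exp_mul_trace_re (x : ℝ) :
    ∫⁻ u, ENNReal.ofReal (Real.exp (x * ((u : Matrix.unitaryGroup n ℂ) : Matrix n n ℂ).trace.re))
        ∂(haarProbability (Matrix.unitaryGroup n ℂ))
      = ENNReal.ofReal
          ((Matrix.of fun i j : n => besselI (((enum n i : ℕ) : ℤ) - ((enum n j : ℕ) : ℤ)).natAbs x).det) := by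
  have hF : Measurable fun u : Matrix.unitaryGroup n ℂ =>
      ENNReal.ofReal (Real.exp (x * ((u : Matrix.unitaryGroup n ℂ) : Matrix n n ℂ).trace.re)) :=
    ENNReal.measurable_ofReal.comp ((Real.continuous_exp.comp (continuous_const.mul
      (Complex.continuous_re.comp (continuous_id.matrix_trace.comp continuous_subtype_val)))).measurable)
  have hcl : ∀ g u : Matrix.unitaryGroup n ℂ,
      ENNReal.ofReal (Real.exp (x * (((g * u * g⁻¹ : Matrix.unitaryGroup n ℂ)) : Matrix n n ℂ).trace.re))
        = ENNReal.ofReal (Real.exp (x * ((u : Matrix.unitaryGroup n ℂ) : Matrix n n ℂ).trace.re)) := by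
    intro g u
    rw [trace_conj_unitaryGroup]
  rw [lintegral_unitaryGroup_eq_angleIntegral hF hcl, angleIntegral]
  simp_rw [trace_re_torusPt]
  rw [show (volume : Measure (n → ℝ)).restrict (Set.pi Set.univ fun _ => Set.Ioc (-π) π) =
    Measure.pi fun _ : n => (volume : Measure ℝ).restrict (Set.Ioc (-π) π) from Measure.restrict_pi_pi _ _]
  have hprod : ∀ θ : n → ℝ, ENNReal.ofReal (Real.exp (x * ∑ b, Real.cos (θ b))) *
      ENNReal.ofReal (∏ p : OD n, ‖cexp (θ p.1.1 * I) - cexp (θ p.1.2 * I)‖ ^ 2)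
      = ENNReal.ofReal (Real.exp (x * ∑ b, Real.cos (θ b)) *
          ∏ p : OD n, ‖cexp (θ p.1.1 * I) - cexp (θ p.1.2 * I)‖ ^ 2) := fun θ =>
    (ENNReal.ofReal_mul (Real.exp_nonneg _)).symm
  simp_rw [hprod]
  have hint := integrable_cube_exp_mul_sum_cos_mul_prod_norm_sub_sq (n := n) x
  have h2pi : ENNReal.ofReal ((2 * π) ^ Fintype.card n * (Fintype.card n).factorial)
      = ENNReal.ofReal (2 * π) ^ Fintype.card n * (Fintype.card n).factorial := by
    rw [ENNReal.ofReal_mul (q := ((Fintype.card n).factorial : ℝ)) (pow_nonneg Real.two_pi_pos.le _),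
      ENNReal.ofReal_pow Real.two_pi_pos.le, ENNReal.ofReal_natCast]
  rw [← ofReal_integral_eq_lintegral_ofReal hint (Filter.Eventually.of_forall fun θ =>
      mul_nonneg (Real.exp_nonneg _) (Finset.prod_nonneg fun p _ => sq_nonneg _)),
    integral_cube_exp_mul_sum_cos_mul_prod_norm_sub_sq, ENNReal.ofReal_mul' (det_besselI_toeplitz_enum_nonneg x),
    h2pi, ← mul_assoc,
    ENNReal.inv_mul_cancel (mul_ne_zero (pow_ne_zero _ (ENNReal.ofReal_pos.2 Real.two_pi_pos).ne')
      (Nat.cast_ne_zero.2 (Nat.factorial_ne_zero _))) (ENNReal.mul_ne_top (ENNReal.pow_ne_top ENNReal.ofReal_ne_top)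
      (ENNReal.natCast_ne_top _)), one_mul]

/-- Reindexing the Toeplitz determinant from `n` (through `enum n`) to `Fin N`. -/
theorem det_besselI_toeplitz_enum_eq (x : ℝ) :
    (Matrix.of fun i j : n => besselI (((enum n i : ℕ) : ℤ) - ((enum n j : ℕ) : ℤ)).natAbs x).det
      = (Matrix.of fun i j : Fin (Fintype.card n) => besselI ((i : ℤ) - (j : ℤ)).natAbs x).det := by
  rw [show (Matrix.of fun i j : n => besselI (((enum n i : ℕ) : ℤ) - ((enum n j : ℕ) : ℤ)).natAbs x)
      = (Matrix.of fun i j : Fin (Fintype.card n) => besselI ((i : ℤ) - (j : ℤ)).natAbs x).submatrix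
          (enum n) (enum n) from by ext i j; rfl, Matrix.det_submatrix_equiv_self]

/-- **THE `U(N)` ONE-PLAQUETTE PARTITION FUNCTION FOR EVERY `N` (Bars–Green / Gross–Witten)**: for every finite
index type `n` with `|n| = N` and every real `x`,
`∫_{U(n)} e^{x Re tr U} dU = det[I_{|i−j|}(x)]_{i,j < N}`,
the `N × N` Toeplitz determinant of modified Bessel functions (normalised Haar measure). -/
theorem integral_haar_unitaryGroup_exp_mul_trace_re (x : ℝ) :
    ∫ u, Real.exp (x * ((u : Matrix.unitaryGroup n ℂ) : Matrix n n ℂ).trace.re)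
        ∂(haarProbability (Matrix.unitaryGroup n ℂ))
      = (Matrix.of fun i j : Fin (Fintype.card n) => besselI ((i : ℤ) - (j : ℤ)).natAbs x).det := by
  have hc : Continuous fun u : Matrix.unitaryGroup n ℂ =>
      Real.exp (x * ((u : Matrix.unitaryGroup n ℂ) : Matrix n n ℂ).trace.re) :=
    Real.continuous_exp.comp (continuous_const.mul (Complex.continuous_re.comp
      (continuous_id.matrix_trace.comp continuous_subtype_val)))
  rw [integral_eq_lintegral_of_nonneg_ae (Filter.Eventually.of_forall fun u => Real.exp_nonneg _)
    hc.aestronglyMeasurable, lintegral_haar_unitaryGroup_exp_mul_trace_re,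
    ENNReal.toReal_ofReal (det_besselI_toeplitz_enum_nonneg x), det_besselI_toeplitz_enum_eq]

/-- **The Toeplitz determinant `det[I_{|i−j|}(x)]_{N×N}` is POSITIVE** for every `N = |n|` and real `x` (it is the
Haar integral of the positive function `e^{x Re tr U}` over `U(n)`). -/
theorem det_besselI_toeplitz_pos (x : ℝ) :
    0 < (Matrix.of fun i j : Fin (Fintype.card n) => besselI ((i : ℤ) - (j : ℤ)).natAbs x).det := by
  rw [← integral_haar_unitaryGroup_exp_mul_trace_re (n := n) x]
  have hc : Continuous fun u : Matrix.unitaryGroup n ℂ =>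
      Real.exp (x * ((u : Matrix.unitaryGroup n ℂ) : Matrix n n ℂ).trace.re) :=
    Real.continuous_exp.comp (continuous_const.mul (Complex.continuous_re.comp
      (continuous_id.matrix_trace.comp continuous_subtype_val)))
  have hint : Integrable (fun u : Matrix.unitaryGroup n ℂ =>
      Real.exp (x * ((u : Matrix.unitaryGroup n ℂ) : Matrix n n ℂ).trace.re))
      (haarProbability (Matrix.unitaryGroup n ℂ)) := by
    refine Integrable.mono' (integrable_const (Real.exp (|x| * Fintype.card n))) hc.aestronglyMeasurable
      (Filter.Eventually.of_forall fun u => ?_)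
    rw [Real.norm_of_nonneg (Real.exp_nonneg _)]
    refine Real.exp_le_exp.2 ?_
    calc x * ((u : Matrix.unitaryGroup n ℂ) : Matrix n n ℂ).trace.re
        ≤ |x * ((u : Matrix.unitaryGroup n ℂ) : Matrix n n ℂ).trace.re| := le_abs_self _
      _ = |x| * |((u : Matrix.unitaryGroup n ℂ) : Matrix n n ℂ).trace.re| := abs_mul _ _
      _ ≤ |x| * Fintype.card n := by
          refine mul_le_mul_of_nonneg_left ?_ (abs_nonneg _)
          rw [Matrix.trace, Complex.re_sum]
          calc |∑ i, (((u : Matrix.unitaryGroup n ℂ) : Matrix n n ℂ) i i).re|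
              ≤ ∑ i, |(((u : Matrix.unitaryGroup n ℂ) : Matrix n n ℂ) i i).re| := Finset.abs_sum_le_sum_abs _ _
            _ ≤ ∑ _i : n, (1 : ℝ) := Finset.sum_le_sum fun i _ =>
                (Complex.abs_re_le_norm _).trans (entry_norm_bound_of_unitary u.2 i i)
            _ = Fintype.card n := by simp
  exact integral_exp_pos hint

/-! ### 5. `U(N)` literally (`n = Fin N`), theory-2's one-plaquette integral, and the case `N = 1` -/

/-- Reindexing `Fin |Fin N| = Fin N` in the Toeplitz determinant. -/
theorem det_besselI_toeplitz_fin_card (N : ℕ) (x : ℝ) :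
    (Matrix.of fun i j : Fin (Fintype.card (Fin N)) => besselI ((i : ℤ) - (j : ℤ)).natAbs x).det
      = (Matrix.of fun i j : Fin N => besselI ((i : ℤ) - (j : ℤ)).natAbs x).det := by
  rw [show (Matrix.of fun i j : Fin (Fintype.card (Fin N)) => besselI ((i : ℤ) - (j : ℤ)).natAbs x)
      = (Matrix.of fun i j : Fin N => besselI ((i : ℤ) - (j : ℤ)).natAbs x).submatrix
          (finCongr (Fintype.card_fin N)) (finCongr (Fintype.card_fin N)) from by ext i j; simp,
    Matrix.det_submatrix_equiv_self]

/-- **THE `U(N)` ONE-PLAQUETTE PARTITION FUNCTION** (Bars–Green 1979 (1.4)–(1.6); Gross–Witten 1980):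
for every `N` and every real `x`, `∫_{U(N)} e^{x Re tr U} dU = det[I_{|i−j|}(x)]_{i,j < N}`. -/
theorem integral_haar_unitaryGroup_fin_exp_mul_trace_re (N : ℕ) (x : ℝ) :
    ∫ u, Real.exp (x * ((u : Matrix.unitaryGroup (Fin N) ℂ) : Matrix (Fin N) (Fin N) ℂ).trace.re)
        ∂(haarProbability (Matrix.unitaryGroup (Fin N) ℂ))
      = (Matrix.of fun i j : Fin N => besselI ((i : ℤ) - (j : ℤ)).natAbs x).det := by
  rw [integral_haar_unitaryGroup_exp_mul_trace_re, det_besselI_toeplitz_fin_card]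

/-- `det[I_{|i−j|}(x)]_{N×N} > 0` for every `N` and real `x`. -/
theorem det_besselI_toeplitz_fin_pos (N : ℕ) (x : ℝ) :
    0 < (Matrix.of fun i j : Fin N => besselI ((i : ℤ) - (j : ℤ)).natAbs x).det := by
  rw [← det_besselI_toeplitz_fin_card]
  exact det_besselI_toeplitz_pos (n := Fin N) x

/-- **theory-2's `U(N)` ONE-PLAQUETTE INTEGRAL IN CLOSED FORM**: for the Wilson action of the fundamental
representation of `U(N)`, `z₁(β) = ∫_{U(N)} e^{−β(N − Re tr U)} dU = e^{−Nβ} det[I_{|i−j|}(β)]_{i,j<N}`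
(so, by row 30's two-dimensional independence of plaquettes, the 2-d `U(N)` torus free energy density is
`−Nβ + log det[I_{|i−j|}(β)]`, exactly as `TorusFreeEnergyDensity2D` reads it for `SU(3)`). -/
theorem z1_unitary_eq_det (N : ℕ) (β : ℝ) :
    Theory2.Lattice.z1 (unitaryFundamentalRep (Fin N) ℂ) β
      = ENNReal.ofReal (Real.exp (-(N * β)) *
          (Matrix.of fun i j : Fin N => besselI ((i : ℤ) - (j : ℤ)).natAbs β).det) := by
  unfold Theory2.Lattice.z1
  simp only [unitaryFundamentalRep_apply]
  have hsplit : ∀ u : Matrix.unitaryGroup (Fin N) ℂ,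
      ENNReal.ofReal (Real.exp (-(β * ((N : ℝ) - ((u : Matrix.unitaryGroup (Fin N) ℂ) :
          Matrix (Fin N) (Fin N) ℂ).trace.re))))
        = ENNReal.ofReal (Real.exp (-(N * β))) *
          ENNReal.ofReal (Real.exp (β * ((u : Matrix.unitaryGroup (Fin N) ℂ) : Matrix (Fin N) (Fin N) ℂ).trace.re)) := by
    intro u
    rw [← ENNReal.ofReal_mul (Real.exp_nonneg _), ← Real.exp_add]
    congr 2
    ring
  simp_rw [hsplit]
  rw [lintegral_const_mul' _ _ ENNReal.ofReal_ne_top, lintegral_haar_unitaryGroup_exp_mul_trace_re,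
    ← ENNReal.ofReal_mul (Real.exp_nonneg _), det_besselI_toeplitz_enum_eq, det_besselI_toeplitz_fin_card]

/-- Sanity check `N = 1` (`U(1)`, one plaquette): `∫_{U(1)} e^{x Re tr U} dU = I₀(x)` — the `1 × 1` determinant. -/
theorem integral_haar_unitaryGroup_one_exp_mul_trace_re (x : ℝ) :
    ∫ u, Real.exp (x * ((u : Matrix.unitaryGroup (Fin 1) ℂ) : Matrix (Fin 1) (Fin 1) ℂ).trace.re)
        ∂(haarProbability (Matrix.unitaryGroup (Fin 1) ℂ)) = besselI 0 x := by
  rw [integral_haar_unitaryGroup_fin_exp_mul_trace_re, Matrix.det_unique]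
  simp

/-- Sanity check `N = 1` in theory-2's vocabulary: `z₁^{U(1)}(β) = e^{−β} I₀(β)` (GEN-7's `U(1)` one-plaquette
law `⟨cos θ⟩ = I₁/I₀` lives on this normalisation). -/
theorem z1_unitary_one (β : ℝ) :
    Theory2.Lattice.z1 (unitaryFundamentalRep (Fin 1) ℂ) β = ENNReal.ofReal (Real.exp (-β) * besselI 0 β) := by
  rw [z1_unitary_eq_det, Matrix.det_unique]
  simp

/-- Sanity check `N = 2`: `∫_{U(2)} e^{x Re tr U} dU = I₀(x)² − I₁(x)²` — the `2 × 2` Toeplitz determinant. -/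
theorem integral_haar_unitaryGroup_two_exp_mul_trace_re (x : ℝ) :
    ∫ u, Real.exp (x * ((u : Matrix.unitaryGroup (Fin 2) ℂ) : Matrix (Fin 2) (Fin 2) ℂ).trace.re)
        ∂(haarProbability (Matrix.unitaryGroup (Fin 2) ℂ)) = besselI 0 x ^ 2 - besselI 1 x ^ 2 := by
  rw [integral_haar_unitaryGroup_fin_exp_mul_trace_re, Matrix.det_fin_two]
  simp [Matrix.of_apply]
  ring

end Summit.Ventures.LatticeQCDFlow.Scoring
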